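import Literature.NumberTheory.Weil1965.SplitPlaceFibreDensity
import Literature.NumberTheory.Weil1965.SplitPlaceFibreDensityScaling
import Mathlib.MeasureTheory.Integral.RieszMarkovKakutani.Real
import HarnessLib

/-!
# The fibre MEASURES `μ_{b,v}` of the split form `h(x, y) = x ⬝ᵥ y` (Riesz bridge for Weil's Lemma 22 at a split place)

Topic `NumberTheory/Weil1965`; namespace `Literature.NumberTheory.Weil1965.SplitPlace`. KERNEL mathematics only (definitions
with bodies + theorems; no named fact, no `axiom`, no `sorry`). Sequel of `SplitPlaceFibreDensity.lean`.

Weil's one-place argument [Weil1965, Chap. V n° 49 Lemma 22, n° 50 Thm 4] compares two `G′_v`-invariant positive MEASURES carried by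
a fibre `U(b)_v`; the uniqueness of such measures is ★ `MeasureTheory/Group/InvariantQuotientUniqueness` ∕ row I-UNIQ, which speaks of
`Measure`s. This file turns the fibre-density FUNCTIONAL `Φ ↦ fibreDensity μ Φ b` of FILE A into a Radon measure:

* `fibreAvgReal μ f b r` — the real fibre averages of a real function (`= fibreAvg` after `Complex.ofReal`, `ofReal_fibreAvgReal`);
* `exists_bruhat_approx` — a compactly supported continuous real `f` on `K^ι × K^ι` is UNIFORMLY approximated by real Schwartz–Bruhat
  functions supported in a fixed product of boxes (values of `f` at chosen representatives of the level-`m` cosets);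
* `tendsto_fibreAvgReal` — for `|ι| ≥ 2` and EVERY `f ∈ C_c(K^ι × K^ι, ℝ)` the fibre averages converge (Cauchy via the Bruhat
  approximation and `tendsto_fibreAvg`); the limit `fibreFunctional μ hι b : C_c →ₚ[ℝ] ℝ` is a POSITIVE LINEAR functional;
* **`fibreMeasure μ hι b := RealRMK.rieszMeasure (fibreFunctional μ hι b)`** — Weil's `|θ_b|_v` as a MEASURE — with
  `integral_fibreMeasure : ∫ f ∂(fibreMeasure μ hι b) = lim_r fibreAvgReal μ f b r` for `f ∈ C_c` and
  **`integral_fibreMeasure_eq_fibreDensity`**: `∫ Φ ∂(fibreMeasure μ hι b) = fibreDensity μ Φ b` for Schwartz–Bruhat `Φ`.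

## References

* [Weil1965] A. Weil, *Sur la formule de Siegel dans la théorie des groupes classiques*, Acta Math. 113 (1965) 1–87: Chap. IV n° 44
  Thm 2 p. 63 (the measures `μ_i = |θ_i|_A`), Chap. V n° 49 Lemma 22 p. 70, n° 50 Thm 4 p. 72.
* [WeilBNT1967] A. Weil, *Basic Number Theory* (1967), Ch. VII §2 Prop. 2 (standard functions), Ch. II §2 Def. 2 (boxes).
-/

noncomputable section

namespace Literature.NumberTheory.Weil1965.SplitPlace

open _root_.MeasureTheory _root_.Filter _root_.Set Literature.NumberTheory.Automorphic
open Literature.NumberTheory.Automorphic.LocalFieldHaar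
open scoped Topology Pointwise NNReal ENNReal
open Literature.NumberTheory.GaloisRepresentations.IsNonarchimedeanLocalField
open CompactlySupported

variable {K : Type*} [Field K] [ValuativeRel K] [TopologicalSpace K] [IsNonarchimedeanLocalField K]
variable {ι : Type*} [Fintype ι] [MeasurableSpace K] [BorelSpace K] (μ : Measure K) [μ.IsAddHaarMeasure]

/-! ## §1 Real fibre averages -/

/-- the real fibre averages `μ(𝔭^r)⁻¹ ∫_X 𝟙_{b+𝔭^r}(x ⬝ᵥ y) f(x, y)` of a real function. [cite: Weil1965, Chap. IV n° 44 Thm 2, p. 63] -/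
def fibreAvgReal (f : (ι → K) × (ι → K) → ℝ) (b : K) (r : ℤ) : ℝ :=
  (μ.real (primePowBall K r))⁻¹ *
    ∫ z, (b +ᵥ primePowBall K r).indicator (1 : K → ℝ) (z.1 ⬝ᵥ z.2) * f z
      ∂((Measure.pi fun _ : ι => μ).prod (Measure.pi fun _ : ι => μ))

omit [BorelSpace K] [μ.IsAddHaarMeasure] in
/-- `fibreAvg` of the complexified function is the complexification of `fibreAvgReal`. [cite: Weil1965, Chap. IV n° 44 Thm 2, p. 63] -/
theorem ofReal_fibreAvgReal (f : (ι → K) × (ι → K) → ℝ) (b : K) (r : ℤ) :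
    (fibreAvgReal μ f b r : ℂ) = fibreAvg μ (fun z => (f z : ℂ)) b r := by
  rw [fibreAvgReal, fibreAvg, Complex.ofReal_mul, Complex.ofReal_inv, ← integral_complex_ofReal]
  congr 1
  refine integral_congr_ae (Eventually.of_forall fun z => ?_)
  simp only [Complex.ofReal_mul]
  congr 1
  by_cases h : z.1 ⬝ᵥ z.2 ∈ b +ᵥ primePowBall K r
  · rw [Set.indicator_of_mem h, Set.indicator_of_mem h]; simp
  · rw [Set.indicator_of_notMem h, Set.indicator_of_notMem h]; simp

/-- the real fibre averages are monotone in `f` (the integrand is a non-negative weight times `f`) — pointwise domination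
`|f| ≤ g` gives `|A_r(f)| ≤ A_r(g)` for integrable `g`. [cite: Weil1965, Chap. V n° 48 Lemma 21, p. 68] -/
theorem abs_fibreAvgReal_le {f g : (ι → K) × (ι → K) → ℝ} (hfg : ∀ z, |f z| ≤ g z)
    (hg : Integrable g ((Measure.pi fun _ : ι => μ).prod (Measure.pi fun _ : ι => μ))) (b : K) (r : ℤ) :
    |fibreAvgReal μ f b r| ≤ fibreAvgReal μ g b r := by
  haveI : SecondCountableTopology K := secondCountableTopology_localField K
  have hind : ∀ z : (ι → K) × (ι → K), 0 ≤ (b +ᵥ primePowBall K r).indicator (1 : K → ℝ) (z.1 ⬝ᵥ z.2) ∧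
      (b +ᵥ primePowBall K r).indicator (1 : K → ℝ) (z.1 ⬝ᵥ z.2) ≤ 1 := by
    intro z
    by_cases h : z.1 ⬝ᵥ z.2 ∈ b +ᵥ primePowBall K r
    · rw [Set.indicator_of_mem h]; simp
    · rw [Set.indicator_of_notMem h]; simp
  have hmeas : Measurable fun z : (ι → K) × (ι → K) => (b +ᵥ primePowBall K r).indicator (1 : K → ℝ) (z.1 ⬝ᵥ z.2) := by
    have h1 : Measurable fun z : (ι → K) × (ι → K) => z.1 ⬝ᵥ z.2 :=
      (continuous_finsetSum _ fun i _ => ((continuous_apply i).comp continuous_fst).mul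
        ((continuous_apply i).comp continuous_snd)).measurable
    exact (measurable_const.indicator (measurableSet_vadd_primePowBall r b)).comp h1
  rw [fibreAvgReal, fibreAvgReal, abs_mul, abs_inv, abs_of_pos (measureReal_primePowBall_pos μ r)]
  refine mul_le_mul_of_nonneg_left ?_ (inv_nonneg.2 (measureReal_primePowBall_pos μ r).le)
  refine (abs_integral_le_integral_abs).trans (integral_mono_of_nonneg (Eventually.of_forall fun _ => abs_nonneg _)
    ((hg.norm.mono' (hmeas.aestronglyMeasurable.mul hg.1) (Eventually.of_forall fun z => ?_)))
    (Eventually.of_forall fun z => ?_))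
  · rw [norm_mul, Real.norm_eq_abs, Real.norm_eq_abs, abs_of_nonneg (hind z).1]
    exact mul_le_of_le_one_left (abs_nonneg _) (hind z).2
  · simp only [abs_mul, abs_of_nonneg (hind z).1]
    exact mul_le_mul_of_nonneg_left (hfg z) (hind z).1


omit [μ.IsAddHaarMeasure] in
/-- linearity of the real fibre averages in `f` (for integrable `f, g`). [cite: Weil1965, Chap. IV n° 44 Thm 2, p. 63] -/
theorem fibreAvgReal_add {f g : (ι → K) × (ι → K) → ℝ}
    (hf : Integrable f ((Measure.pi fun _ : ι => μ).prod (Measure.pi fun _ : ι => μ)))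
    (hg : Integrable g ((Measure.pi fun _ : ι => μ).prod (Measure.pi fun _ : ι => μ))) (b : K) (r : ℤ) :
    fibreAvgReal μ (f + g) b r = fibreAvgReal μ f b r + fibreAvgReal μ g b r := by
  haveI : SecondCountableTopology K := secondCountableTopology_localField K
  have hmeas : Measurable fun z : (ι → K) × (ι → K) => (b +ᵥ primePowBall K r).indicator (1 : K → ℝ) (z.1 ⬝ᵥ z.2) := by
    have h1 : Measurable fun z : (ι → K) × (ι → K) => z.1 ⬝ᵥ z.2 :=
      (continuous_finsetSum _ fun i _ => ((continuous_apply i).comp continuous_fst).mul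
        ((continuous_apply i).comp continuous_snd)).measurable
    exact (measurable_const.indicator (measurableSet_vadd_primePowBall r b)).comp h1
  have hbd : ∀ z : (ι → K) × (ι → K), ‖(b +ᵥ primePowBall K r).indicator (1 : K → ℝ) (z.1 ⬝ᵥ z.2)‖ ≤ 1 := by
    intro z
    by_cases h : z.1 ⬝ᵥ z.2 ∈ b +ᵥ primePowBall K r
    · rw [Set.indicator_of_mem h]; simp
    · rw [Set.indicator_of_notMem h]; simp
  have hi : ∀ {u : (ι → K) × (ι → K) → ℝ}, Integrable u ((Measure.pi fun _ : ι => μ).prod (Measure.pi fun _ : ι => μ)) →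
      Integrable (fun z => (b +ᵥ primePowBall K r).indicator (1 : K → ℝ) (z.1 ⬝ᵥ z.2) * u z)
        ((Measure.pi fun _ : ι => μ).prod (Measure.pi fun _ : ι => μ)) := fun {u} hu =>
    hu.norm.mono' (hmeas.aestronglyMeasurable.mul hu.1) (Eventually.of_forall fun z => by
      rw [norm_mul]; exact mul_le_of_le_one_left (norm_nonneg _) (hbd z))
  rw [fibreAvgReal, fibreAvgReal, fibreAvgReal, ← mul_add, ← integral_add (hi hf) (hi hg)]
  congr 1
  refine integral_congr_ae (Eventually.of_forall fun z => ?_)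
  simp only [Pi.add_apply, mul_add]

omit [BorelSpace K] [μ.IsAddHaarMeasure] in
/-- homogeneity of the real fibre averages. [cite: Weil1965, Chap. IV n° 44 Thm 2, p. 63] -/
theorem fibreAvgReal_smul (c : ℝ) (f : (ι → K) × (ι → K) → ℝ) (b : K) (r : ℤ) :
    fibreAvgReal μ (c • f) b r = c * fibreAvgReal μ f b r := by
  rw [fibreAvgReal, fibreAvgReal, mul_left_comm, ← integral_const_mul c]
  congr 1
  refine integral_congr_ae (Eventually.of_forall fun z => ?_)
  simp only [Pi.smul_apply, smul_eq_mul]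
  ring

omit [BorelSpace K] in
/-- positivity of the real fibre averages. [cite: Weil1965, Chap. V n° 48 Lemma 21, p. 68] -/
theorem fibreAvgReal_nonneg {f : (ι → K) × (ι → K) → ℝ} (hf : ∀ z, 0 ≤ f z) (b : K) (r : ℤ) :
    0 ≤ fibreAvgReal μ f b r := by
  refine mul_nonneg (inv_nonneg.2 (measureReal_primePowBall_pos μ r).le) (integral_nonneg fun z => ?_)
  refine mul_nonneg ?_ (hf z)
  by_cases h : z.1 ⬝ᵥ z.2 ∈ b +ᵥ primePowBall K r
  · rw [Set.indicator_of_mem h]; simp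
  · rw [Set.indicator_of_notMem h]

/-! ## §2 Uniform approximation of `C_c` by Schwartz–Bruhat functions, and the limit for continuous test functions -/

omit [Fintype ι] [MeasurableSpace K] [BorelSpace K] in
/-- cosets of a product box through one of its points coincide. [cite: WeilBNT1967, Ch. II §2, Def. 2] -/
theorem vadd_boxProd_eq_of_mem {m : ℤ} {z w : (ι → K) × (ι → K)}
    (hw : w ∈ z +ᵥ piPrimePowBall K ι m ×ˢ piPrimePowBall K ι m) :
    w +ᵥ piPrimePowBall K ι m ×ˢ piPrimePowBall K ι m = z +ᵥ piPrimePowBall K ι m ×ˢ piPrimePowBall K ι m := by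
  obtain ⟨t, ht, rfl⟩ := Set.mem_vadd_set.1 hw
  ext u
  constructor
  · rintro ⟨s, hs, rfl⟩
    refine ⟨t + s, ⟨add_mem_piPrimePowBall ht.1 hs.1, add_mem_piPrimePowBall ht.2 hs.2⟩, ?_⟩
    simp [vadd_eq_add, add_assoc]
  · rintro ⟨s, hs, rfl⟩
    refine ⟨s - t, ⟨?_, ?_⟩, ?_⟩
    · rw [Prod.fst_sub, sub_eq_add_neg]; exact add_mem_piPrimePowBall hs.1 (neg_mem_piPrimePowBall ht.1)
    · rw [Prod.snd_sub, sub_eq_add_neg]; exact add_mem_piPrimePowBall hs.2 (neg_mem_piPrimePowBall ht.2)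
    · simp only [vadd_eq_add]; abel

omit [Fintype ι] [MeasurableSpace K] [BorelSpace K] in
/-- nesting of cosets of product boxes: for `m' ≤ m`, the level-`m` coset through a point of a level-`m'` coset lies inside it.
[cite: WeilBNT1967, Ch. II §2, Def. 2] -/
theorem vadd_boxProd_subset_of_mem {m m' : ℤ} (hm : m' ≤ m) {z w : (ι → K) × (ι → K)}
    (hw : w ∈ z +ᵥ piPrimePowBall K ι m' ×ˢ piPrimePowBall K ι m') :
    w +ᵥ piPrimePowBall K ι m ×ˢ piPrimePowBall K ι m ⊆ z +ᵥ piPrimePowBall K ι m' ×ˢ piPrimePowBall K ι m' := by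
  obtain ⟨t, ht, rfl⟩ := Set.mem_vadd_set.1 hw
  rintro u ⟨s, hs, rfl⟩
  refine ⟨t + s, ⟨add_mem_piPrimePowBall ht.1 (piPrimePowBall_antitone hm hs.1),
    add_mem_piPrimePowBall ht.2 (piPrimePowBall_antitone hm hs.2)⟩, ?_⟩
  simp [vadd_eq_add, add_assoc]

omit [MeasurableSpace K] [BorelSpace K] in
/-- a compactly supported continuous function on `K^ι × K^ι` vanishes off some product of boxes.
[cite: WeilBNT1967, Ch. VII §2, Prop. 2] -/
theorem exists_eq_zero_of_notMem_boxProd (f : C_c((ι → K) × (ι → K), ℝ)) :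
    ∃ n₀ : ℤ, ∀ z, z ∉ piPrimePowBall K ι n₀ ×ˢ piPrimePowBall K ι n₀ → f z = 0 := by
  have hcs : HasCompactSupport f := f.hasCompactSupport
  have hbox : ∀ M M' : ℤ, M ≤ M' → piPrimePowBall K ι M' ×ˢ piPrimePowBall K ι M' ⊆
      piPrimePowBall K ι M ×ˢ piPrimePowBall K ι M := fun M M' h =>
    Set.prod_mono (piPrimePowBall_antitone h) (piPrimePowBall_antitone h)
  have hcover : tsupport f ⊆ ⋃ k : ℕ, piPrimePowBall K ι (-(k : ℤ)) ×ˢ piPrimePowBall K ι (-(k : ℤ)) := by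
    intro z _
    obtain ⟨k₁, hk₁⟩ := exists_mem_piPrimePowBall z.1
    obtain ⟨k₂, hk₂⟩ := exists_mem_piPrimePowBall z.2
    refine Set.mem_iUnion.2 ⟨max k₁ k₂, ?_, ?_⟩
    · exact piPrimePowBall_antitone (by simp) hk₁
    · exact piPrimePowBall_antitone (by simp) hk₂
  have hdir : Directed (· ⊆ ·) fun k : ℕ => piPrimePowBall K ι (-(k : ℤ)) ×ˢ piPrimePowBall K ι (-(k : ℤ)) :=
    Monotone.directed_le fun a b hab => hbox _ _ (by omega)
  obtain ⟨k₀, hk₀⟩ := hcs.elim_directed_cover _ (fun k => (isOpen_piPrimePowBall _).prod (isOpen_piPrimePowBall _))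
    hcover hdir
  exact ⟨-(k₀ : ℤ), fun z hz => image_eq_zero_of_notMem_tsupport fun h => hz (hk₀ h)⟩

omit [MeasurableSpace K] [BorelSpace K] in
/-- **uniform approximation by Schwartz–Bruhat functions**: a compactly supported continuous real `f` on `K^ι × K^ι` is, for every
`ε > 0`, within `ε` of a LOCALLY CONSTANT function supported in a product of boxes containing the support of `f` (the values of
`f` at chosen points of the level-`m` cosets, `m` fine enough — uniform continuity through a finite subcover of the compact box).
[cite: WeilBNT1967, Ch. VII §2, Prop. 2] -/
theorem exists_locallyConstant_approx (f : C_c((ι → K) × (ι → K), ℝ)) {n₀ : ℤ}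
    (hn₀ : ∀ z, z ∉ piPrimePowBall K ι n₀ ×ˢ piPrimePowBall K ι n₀ → f z = 0) {ε : ℝ} (hε : 0 < ε) :
    ∃ Φ : (ι → K) × (ι → K) → ℝ, IsLocallyConstant Φ ∧
      (∀ z, z ∉ piPrimePowBall K ι n₀ ×ˢ piPrimePowBall K ι n₀ → Φ z = 0) ∧ ∀ z, |f z - Φ z| ≤ ε := by
  classical
  set B := piPrimePowBall K ι n₀ ×ˢ piPrimePowBall K ι n₀ with hB
  have hBc : IsCompact B := (isCompact_piPrimePowBall n₀).prod (isCompact_piPrimePowBall n₀)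
  -- local oscillation control
  have hloc : ∀ z : (ι → K) × (ι → K), ∃ m : ℕ, ∀ w ∈ z +ᵥ piPrimePowBall K ι (m : ℤ) ×ˢ piPrimePowBall K ι (m : ℤ),
      |f w - f z| < ε / 2 := by
    intro z
    have h1 : {w | |f w - f z| < ε / 2} ∈ 𝓝 z := by
      have hc : Continuous fun w => |f w - f z| := (f.continuous.sub continuous_const).abs
      exact hc.isOpen_preimage _ isOpen_Iio |>.mem_nhds (by simp [hε])
    have h2 : (fun t => z + t) ⁻¹' {w | |f w - f z| < ε / 2} ∈ 𝓝 (0 : (ι → K) × (ι → K)) :=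
      (continuous_const.add continuous_id).continuousAt.preimage_mem_nhds (by simpa using h1)
    obtain ⟨m, hm⟩ := exists_box_prod_box_subset_of_mem_nhds_zero h2
    refine ⟨m, fun w hw => ?_⟩
    obtain ⟨t, ht, rfl⟩ := Set.mem_vadd_set.1 hw
    exact hm ht
  choose m hm using hloc
  have hU : ∀ z ∈ B, z +ᵥ piPrimePowBall K ι (m z : ℤ) ×ˢ piPrimePowBall K ι (m z : ℤ) ∈ 𝓝 z := fun z _ =>
    (((isOpen_piPrimePowBall _).prod (isOpen_piPrimePowBall _)).vadd z).mem_nhds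
      ⟨0, ⟨zero_mem_piPrimePowBall _, zero_mem_piPrimePowBall _⟩, by simp⟩
  obtain ⟨S, hSB, hS⟩ := hBc.elim_nhds_subcover (fun z => z +ᵥ piPrimePowBall K ι (m z : ℤ) ×ˢ piPrimePowBall K ι (m z : ℤ)) hU
  -- a common fine level `M ≥ n₀`
  set M : ℤ := max n₀ (S.sup m : ℕ) with hM
  have hMn : n₀ ≤ M := le_max_left _ _
  have hMz : ∀ z ∈ S, (m z : ℤ) ≤ M := fun z hz =>
    (Int.ofNat_le.2 (Finset.le_sup hz)).trans (le_max_right _ _)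
  -- the approximant: value of `f` at a chosen point of the level-`M` coset
  set C : (ι → K) × (ι → K) → Set ((ι → K) × (ι → K)) := fun z => z +ᵥ piPrimePowBall K ι M ×ˢ piPrimePowBall K ι M with hC
  have hCne : ∀ z, (C z).Nonempty := fun z => ⟨z, ⟨0, ⟨zero_mem_piPrimePowBall _, zero_mem_piPrimePowBall _⟩, by simp⟩⟩
  set Φ : (ι → K) × (ι → K) → ℝ := fun z => B.indicator (fun z => f (hCne z).some) z with hΦ
  have hCmem : ∀ z, (hCne z).some ∈ C z := fun z => (hCne z).some_mem
  -- `B` is saturated by level-`M` cosets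
  have hBsat : ∀ z ∈ B, C z ⊆ B := by
    intro z hz u hu
    obtain ⟨s, hs, rfl⟩ := Set.mem_vadd_set.1 hu
    exact ⟨add_mem_piPrimePowBall hz.1 (piPrimePowBall_antitone hMn hs.1),
      add_mem_piPrimePowBall hz.2 (piPrimePowBall_antitone hMn hs.2)⟩
  have hzC : ∀ z, z ∈ C z := fun z => ⟨0, ⟨zero_mem_piPrimePowBall _, zero_mem_piPrimePowBall _⟩, by simp⟩
  have hsome : ∀ (s t : Set ((ι → K) × (ι → K))) (hs : s.Nonempty) (ht : t.Nonempty), s = t → hs.some = ht.some := by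
    rintro s t hs ht rfl; rfl
  refine ⟨Φ, ?_, fun z hz => by rw [hΦ]; exact Set.indicator_of_notMem hz _, fun z => ?_⟩
  · -- locally constant: constant on every level-`M` coset
    rw [IsLocallyConstant.iff_exists_open]
    intro z
    refine ⟨C z, ((isOpen_piPrimePowBall _).prod (isOpen_piPrimePowBall _)).vadd z, hzC z, fun w hw => ?_⟩
    have hCw : C w = C z := vadd_boxProd_eq_of_mem hw
    have hrep : (hCne w).some = (hCne z).some := hsome _ _ _ _ hCw
    by_cases hzB : z ∈ B
    · have hwB : w ∈ B := hBsat z hzB hw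
      simp only [hΦ, Set.indicator_of_mem hzB, Set.indicator_of_mem hwB, hrep]
    · have hwB : w ∉ B := fun hwB => hzB (hBsat w hwB (hCw ▸ hzC z))
      simp only [hΦ, Set.indicator_of_notMem hzB, Set.indicator_of_notMem hwB]
  · -- the error estimate
    by_cases hz : z ∈ B
    · simp only [hΦ, Set.indicator_of_mem hz]
      obtain ⟨a, ha, hza⟩ := Set.mem_iUnion₂.1 (hS hz)
      have h1 : |f z - f a| < ε / 2 := hm a z hza
      have h2 : |f (hCne z).some - f a| < ε / 2 :=
        hm a _ (vadd_boxProd_subset_of_mem (hMz a ha) hza (hCmem z))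
      rw [abs_sub_comm] at h2
      calc |f z - f (hCne z).some| = |(f z - f a) + (f a - f (hCne z).some)| := by ring_nf
        _ ≤ |f z - f a| + |f a - f (hCne z).some| := abs_add_le _ _
        _ ≤ ε := by linarith
    · rw [hn₀ z hz, hΦ]; simp only [Set.indicator_of_notMem hz, sub_zero, abs_zero]; exact hε.le

/-! ### The limit of the fibre averages for continuous test functions -/

omit [Fintype ι] [MeasurableSpace K] [BorelSpace K] in
/-- a locally constant compactly supported real function complexifies to a Schwartz–Bruhat function. [cite: WeilBNT1967, Ch. VII §2, Prop. 2] -/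
theorem ofReal_mem_schwartzBruhat {Φ : (ι → K) × (ι → K) → ℝ} (hlc : IsLocallyConstant Φ)
    {n₀ : ℤ} (hs : ∀ z, z ∉ piPrimePowBall K ι n₀ ×ˢ piPrimePowBall K ι n₀ → Φ z = 0) :
    (fun z => (Φ z : ℂ)) ∈ SchwartzBruhat ((ι → K) × (ι → K)) := by
  rw [mem_schwartzBruhat_iff]
  refine ⟨(hlc.comp Complex.ofReal :), HasCompactSupport.intro' ((isCompact_piPrimePowBall n₀).prod
    (isCompact_piPrimePowBall n₀)) ((isClosed_piPrimePowBall n₀).prod (isClosed_piPrimePowBall n₀)) fun z hz => by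
      simp [hs z hz]⟩

/-- for a real Schwartz–Bruhat `Φ` the real fibre averages converge, to `Re F_Φ(b)`. [cite: Weil1965, Chap. IV n° 44 Thm 2, p. 63] -/
theorem tendsto_fibreAvgReal_of_isLocallyConstant [Nonempty ι] [DecidableEq ι] [MeasurableSingletonClass K]
    (hι : 2 ≤ Fintype.card ι) {Φ : (ι → K) × (ι → K) → ℝ} (hlc : IsLocallyConstant Φ)
    {n₀ : ℤ} (hs : ∀ z, z ∉ piPrimePowBall K ι n₀ ×ˢ piPrimePowBall K ι n₀ → Φ z = 0) (b : K) :
    Tendsto (fun r : ℤ => fibreAvgReal μ Φ b r) atTop (𝓝 (fibreDensity μ (fun z => (Φ z : ℂ)) b).re) := by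
  have h := tendsto_fibreAvg μ hι (ofReal_mem_schwartzBruhat hlc hs) b
  have h2 : Tendsto (fun r : ℤ => (fibreAvg μ (fun z => (Φ z : ℂ)) b r).re) atTop
      (𝓝 (fibreDensity μ (fun z => (Φ z : ℂ)) b).re) := (Complex.continuous_re.tendsto _).comp h
  refine h2.congr fun r => ?_
  rw [← ofReal_fibreAvgReal, Complex.ofReal_re]

/-- for a real Schwartz–Bruhat `Φ`, `F_Φ(b)` is real. [cite: Weil1965, Chap. IV n° 44 Thm 2, p. 63] -/
theorem fibreDensity_ofReal_im [Nonempty ι] [DecidableEq ι] [MeasurableSingletonClass K]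
    (hι : 2 ≤ Fintype.card ι) {Φ : (ι → K) × (ι → K) → ℝ} (hlc : IsLocallyConstant Φ)
    {n₀ : ℤ} (hs : ∀ z, z ∉ piPrimePowBall K ι n₀ ×ˢ piPrimePowBall K ι n₀ → Φ z = 0) (b : K) :
    (fibreDensity μ (fun z => (Φ z : ℂ)) b).im = 0 := by
  have h := tendsto_fibreAvg μ hι (ofReal_mem_schwartzBruhat hlc hs) b
  have h2 : Tendsto (fun r : ℤ => (fibreAvg μ (fun z => (Φ z : ℂ)) b r).im) atTop
      (𝓝 (fibreDensity μ (fun z => (Φ z : ℂ)) b).im) := (Complex.continuous_im.tendsto _).comp h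
  have h3 : Tendsto (fun r : ℤ => (fibreAvg μ (fun z => (Φ z : ℂ)) b r).im) atTop (𝓝 0) := by
    refine tendsto_const_nhds.congr fun r => ?_
    rw [← ofReal_fibreAvgReal, Complex.ofReal_im]
  exact tendsto_nhds_unique h2 h3

/-- continuous compactly supported real functions are integrable on `K^ι × K^ι`. [cite: WeilBNT1967, Ch. I §2, Th. 3 Cor. 3] -/
theorem integrable_of_compactlySupported (f : C_c((ι → K) × (ι → K), ℝ)) :
    Integrable f ((Measure.pi fun _ : ι => μ).prod (Measure.pi fun _ : ι => μ)) := by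
  haveI : SecondCountableTopology K := secondCountableTopology_localField K
  exact f.continuous.integrable_of_hasCompactSupport f.hasCompactSupport

/-- **CONVERGENCE OF THE FIBRE AVERAGES FOR CONTINUOUS TEST FUNCTIONS**: for `|ι| ≥ 2` and `f ∈ C_c(K^ι × K^ι, ℝ)` the real fibre
averages `μ(𝔭^r)⁻¹ ∫ 𝟙_{b+𝔭^r}(x ⬝ᵥ y) f` form a Cauchy sequence (uniform Schwartz–Bruhat approximation `|f − Φ| ≤ δ 𝟙_B`, so
`|A_r(f) − A_r(Φ)| ≤ δ A_r(𝟙_B)`, and `A_r(Φ)`, `A_r(𝟙_B)` converge by `tendsto_fibreAvg`), hence converge. [cite: Weil1965, Chap. IV n° 44 Thm 2, p. 63] -/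
theorem cauchySeq_fibreAvgReal [Nonempty ι] [DecidableEq ι] [MeasurableSingletonClass K] (hι : 2 ≤ Fintype.card ι)
    (f : C_c((ι → K) × (ι → K), ℝ)) (b : K) : CauchySeq fun r : ℤ => fibreAvgReal μ f b r := by
  classical
  haveI : SecondCountableTopology K := secondCountableTopology_localField K
  obtain ⟨n₀, hn₀⟩ := exists_eq_zero_of_notMem_boxProd f
  set B := piPrimePowBall K ι n₀ ×ˢ piPrimePowBall K ι n₀ with hB
  -- the reference indicator and its limit
  set χ : (ι → K) × (ι → K) → ℝ := B.indicator (fun _ => (1 : ℝ)) with hχ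
  have hχlc : IsLocallyConstant χ := by
    rw [IsLocallyConstant.iff_exists_open]
    intro z
    by_cases hz : z ∈ B
    · exact ⟨B, (isOpen_piPrimePowBall n₀).prod (isOpen_piPrimePowBall n₀), hz, fun w hw => by
        rw [hχ, Set.indicator_of_mem hw, Set.indicator_of_mem hz]⟩
    · exact ⟨Bᶜ, ((isClosed_piPrimePowBall n₀).prod (isClosed_piPrimePowBall n₀)).isOpen_compl, hz, fun w hw => by
        rw [hχ, Set.indicator_of_notMem (show w ∉ B from hw), Set.indicator_of_notMem hz]⟩
  have hχs : ∀ z, z ∉ B → χ z = 0 := fun z hz => Set.indicator_of_notMem hz _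
  have hχi : Integrable χ ((Measure.pi fun _ : ι => μ).prod (Measure.pi fun _ : ι => μ)) := by
    refine (integrable_indicator_iff ((measurableSet_piPrimePowBall' n₀).prod (measurableSet_piPrimePowBall' n₀))).2
      ((integrableOn_const_iff (C := (1 : ℝ))).2 (Or.inr ?_))
    rw [Measure.prod_prod]
    exact ENNReal.mul_lt_top (measure_pi_piPrimePowBall_lt_top μ n₀) (measure_pi_piPrimePowBall_lt_top μ n₀)
  obtain ⟨N₁, hN₁⟩ := (tendsto_fibreAvgReal_of_isLocallyConstant μ hι hχlc hχs b).eventually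
    (gt_mem_nhds (lt_add_one _)) |>.exists_forall_of_atTop
  set C : ℝ := (fibreDensity μ (fun z => (χ z : ℂ)) b).re + 1 with hC
  have hCpos : 0 < C := by
    have h0 : 0 ≤ fibreAvgReal μ χ b N₁ := fibreAvgReal_nonneg μ (fun z => Set.indicator_nonneg (fun _ _ => zero_le_one) z) b N₁
    linarith [hN₁ N₁ le_rfl]
  rw [Metric.cauchySeq_iff]
  intro ε hε
  -- Schwartz–Bruhat approximation at scale `δ`
  set δ : ℝ := ε / (4 * C) with hδ
  have hδpos : 0 < δ := by positivity
  obtain ⟨Φ, hΦlc, hΦs, hΦ⟩ := exists_locallyConstant_approx f hn₀ hδpos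
  have hfi := integrable_of_compactlySupported μ f
  have hΦi : Integrable Φ ((Measure.pi fun _ : ι => μ).prod (Measure.pi fun _ : ι => μ)) := by
    have hm : (fun z => (Φ z : ℂ)) ∈ SchwartzBruhat ((ι → K) × (ι → K)) := ofReal_mem_schwartzBruhat hΦlc hΦs
    have hc : Continuous Φ := hΦlc.continuous
    exact hc.integrable_of_hasCompactSupport (HasCompactSupport.intro' ((isCompact_piPrimePowBall n₀).prod
      (isCompact_piPrimePowBall n₀)) ((isClosed_piPrimePowBall n₀).prod (isClosed_piPrimePowBall n₀)) hΦs)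
  -- `|A_r(f) - A_r(Φ)| ≤ δ · A_r(χ)` for every `r`
  have hdiff : ∀ r, |fibreAvgReal μ f b r - fibreAvgReal μ Φ b r| ≤ δ * fibreAvgReal μ χ b r := by
    intro r
    have hsub : fibreAvgReal μ f b r - fibreAvgReal μ Φ b r = fibreAvgReal μ (⇑f + (-1 : ℝ) • Φ) b r := by
      rw [fibreAvgReal_add μ hfi (hΦi.smul (-1 : ℝ)), fibreAvgReal_smul]; ring
    rw [hsub, ← fibreAvgReal_smul]
    refine abs_fibreAvgReal_le μ (fun z => ?_) (hχi.smul δ) b r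
    simp only [Pi.add_apply, Pi.smul_apply, smul_eq_mul, neg_one_mul, ← sub_eq_add_neg]
    by_cases hz : z ∈ B
    · rw [hχ, Set.indicator_of_mem hz, mul_one]; exact hΦ z
    · rw [hn₀ z hz, hΦs z hz, sub_zero, abs_zero, hχ, Set.indicator_of_notMem hz, mul_zero]
  -- `A_r(Φ)` is Cauchy
  have hΦc : CauchySeq fun r : ℤ => fibreAvgReal μ Φ b r :=
    (tendsto_fibreAvgReal_of_isLocallyConstant μ hι hΦlc hΦs b).cauchySeq
  rw [Metric.cauchySeq_iff] at hΦc
  obtain ⟨N₂, hN₂⟩ := hΦc (ε / 2) (half_pos hε)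
  refine ⟨max N₁ N₂, fun r hr s hs => ?_⟩
  have hr₁ : N₁ ≤ r := (le_max_left _ _).trans hr
  have hs₁ : N₁ ≤ s := (le_max_left _ _).trans hs
  have h1 := hdiff r
  have h2 := hdiff s
  have h3 := hN₂ r ((le_max_right _ _).trans hr) s ((le_max_right _ _).trans hs)
  rw [Real.dist_eq] at h3 ⊢
  have h4 : δ * fibreAvgReal μ χ b r ≤ δ * C := mul_le_mul_of_nonneg_left (hN₁ r hr₁).le hδpos.le
  have h5 : δ * fibreAvgReal μ χ b s ≤ δ * C := mul_le_mul_of_nonneg_left (hN₁ s hs₁).le hδpos.le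
  have h6 : δ * C = ε / 4 := by rw [hδ]; field_simp
  calc |fibreAvgReal μ f b r - fibreAvgReal μ f b s|
      = |(fibreAvgReal μ f b r - fibreAvgReal μ Φ b r) + (fibreAvgReal μ Φ b r - fibreAvgReal μ Φ b s) +
          (fibreAvgReal μ Φ b s - fibreAvgReal μ f b s)| := by ring_nf
    _ ≤ |fibreAvgReal μ f b r - fibreAvgReal μ Φ b r| + |fibreAvgReal μ Φ b r - fibreAvgReal μ Φ b s| +
          |fibreAvgReal μ Φ b s - fibreAvgReal μ f b s| := abs_add_three _ _ _
    _ < ε := by rw [abs_sub_comm (fibreAvgReal μ Φ b s)]; linarith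

/-- hence the real fibre averages of a continuous compactly supported `f` CONVERGE (completeness of `ℝ`); the limit is
`fibreLimit μ hι f b := lim_r A_r(f; b)`. [cite: Weil1965, Chap. IV n° 44 Thm 2, p. 63] -/
theorem tendsto_fibreAvgReal [Nonempty ι] [DecidableEq ι] [MeasurableSingletonClass K] (hι : 2 ≤ Fintype.card ι)
    (f : C_c((ι → K) × (ι → K), ℝ)) (b : K) :
    Tendsto (fun r : ℤ => fibreAvgReal μ f b r) atTop (𝓝 (limUnder atTop fun r : ℤ => fibreAvgReal μ f b r)) := by
  obtain ⟨L, hL⟩ := cauchySeq_tendsto_of_complete (cauchySeq_fibreAvgReal μ hι f b)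
  rwa [hL.limUnder_eq]

/-! ## §3 The fibre functional and the fibre MEASURE (Riesz–Markov–Kakutani) -/

/-- **the fibre functional** `Λ_b(f) = lim_r μ(𝔭^r)⁻¹ ∫ 𝟙_{b+𝔭^r}(x ⬝ᵥ y) f` on `C_c(K^ι × K^ι, ℝ)` — a POSITIVE LINEAR functional
(limits of positive linear functionals). [cite: Weil1965, Chap. IV n° 44 Thm 2, p. 63] -/
def fibreFunctional [Nonempty ι] [DecidableEq ι] [MeasurableSingletonClass K] (hι : 2 ≤ Fintype.card ι) (b : K) :
    C_c((ι → K) × (ι → K), ℝ) →ₚ[ℝ] ℝ :=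
  PositiveLinearMap.mk₀
    { toFun := fun f => limUnder atTop fun r : ℤ => fibreAvgReal μ f b r
      map_add' := fun f g => by
        have hf := tendsto_fibreAvgReal μ hι f b
        have hg := tendsto_fibreAvgReal μ hι g b
        have hfg := tendsto_fibreAvgReal μ hι (f + g) b
        have h : Tendsto (fun r : ℤ => fibreAvgReal μ (f + g) b r) atTop
            (𝓝 ((limUnder atTop fun r : ℤ => fibreAvgReal μ f b r) + limUnder atTop fun r : ℤ => fibreAvgReal μ g b r)) := by
          refine (hf.add hg).congr fun r => ?_
          rw [CompactlySupportedContinuousMap.coe_add,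
            fibreAvgReal_add μ (integrable_of_compactlySupported μ f) (integrable_of_compactlySupported μ g)]
        exact tendsto_nhds_unique hfg h
      map_smul' := fun c f => by
        have hf := tendsto_fibreAvgReal μ hι f b
        have hcf := tendsto_fibreAvgReal μ hι (c • f) b
        have h : Tendsto (fun r : ℤ => fibreAvgReal μ (c • f) b r) atTop
            (𝓝 (c * limUnder atTop fun r : ℤ => fibreAvgReal μ f b r)) := by
          refine (hf.const_mul c).congr fun r => ?_
          rw [CompactlySupportedContinuousMap.coe_smul, fibreAvgReal_smul]
        simpa using tendsto_nhds_unique hcf h }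
    (fun f hf => by
      have h := tendsto_fibreAvgReal μ hι f b
      exact ge_of_tendsto' h fun r => fibreAvgReal_nonneg μ (fun z => hf z) b r)

/-- the fibre functional is the limit of the fibre averages. [cite: Weil1965, Chap. IV n° 44 Thm 2, p. 63] -/
theorem tendsto_fibreFunctional [Nonempty ι] [DecidableEq ι] [MeasurableSingletonClass K] (hι : 2 ≤ Fintype.card ι) (b : K)
    (f : C_c((ι → K) × (ι → K), ℝ)) :
    Tendsto (fun r : ℤ => fibreAvgReal μ f b r) atTop (𝓝 (fibreFunctional μ hι b f)) :=
  tendsto_fibreAvgReal μ hι f b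

omit [Fintype ι] [MeasurableSpace K] [BorelSpace K] in
/-- instance helper: `K` is second countable. [folklore] -/
private theorem secondCountableR : SecondCountableTopology K := secondCountableTopology_localField K

omit [Fintype ι] [MeasurableSpace K] [BorelSpace K] in
/-- instance helper: `K` is Hausdorff. [folklore] -/
private theorem t2R : T2Space K :=
  (Literature.NumberTheory.GaloisRepresentations.IsNonarchimedeanLocalField.isLocalField K).toT2Space

omit [Fintype ι] [MeasurableSpace K] [BorelSpace K] in
/-- instance helper: `K` is locally compact. [folklore] -/
private theorem locallyCompactR : LocallyCompactSpace K :=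
  (Literature.NumberTheory.GaloisRepresentations.IsNonarchimedeanLocalField.isLocalField K).toLocallyCompactSpace

/-- **THE FIBRE MEASURE `μ_{b,v}`** — Weil's local measure `|θ_b|_v` on `K^ι × K^ι` at a split place, as a (regular Borel) MEASURE: the
Riesz–Markov–Kakutani measure of the fibre functional. [cite: Weil1965, Chap. IV n° 44 Thm 2, p. 63] -/
def fibreMeasure [Nonempty ι] [DecidableEq ι] [MeasurableSingletonClass K] (hι : 2 ≤ Fintype.card ι) (b : K) :
    Measure ((ι → K) × (ι → K)) := by
  haveI : SecondCountableTopology K := secondCountableR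
  haveI : T2Space K := t2R
  haveI : LocallyCompactSpace K := locallyCompactR
  exact RealRMK.rieszMeasure (fibreFunctional μ hι b)

/-- **the fibre measure integrates continuous test functions to the limit of the fibre averages**:
`∫ f ∂μ_{b,v} = lim_r μ(𝔭^r)⁻¹ ∫ 𝟙_{b+𝔭^r}(x ⬝ᵥ y) f`. [cite: Weil1965, Chap. IV n° 44 Thm 2, p. 63] -/
theorem integral_fibreMeasure [Nonempty ι] [DecidableEq ι] [MeasurableSingletonClass K] (hι : 2 ≤ Fintype.card ι) (b : K)
    (f : C_c((ι → K) × (ι → K), ℝ)) :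
    ∫ z, f z ∂(fibreMeasure μ hι b) = fibreFunctional μ hι b f := by
  haveI : SecondCountableTopology K := secondCountableR
  haveI : T2Space K := t2R
  haveI : LocallyCompactSpace K := locallyCompactR
  exact RealRMK.integral_rieszMeasure (fibreFunctional μ hι b) f

/-- hence `Tendsto (A_r(f; b)) (𝓝 (∫ f ∂μ_{b,v}))` — vague convergence of the normalised slab measures to `μ_{b,v}`.
[cite: Weil1965, Chap. IV n° 44 Thm 2, p. 63] -/
theorem tendsto_fibreAvgReal_integral_fibreMeasure [Nonempty ι] [DecidableEq ι] [MeasurableSingletonClass K]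
    (hι : 2 ≤ Fintype.card ι) (b : K) (f : C_c((ι → K) × (ι → K), ℝ)) :
    Tendsto (fun r : ℤ => fibreAvgReal μ f b r) atTop (𝓝 (∫ z, f z ∂(fibreMeasure μ hι b))) := by
  rw [integral_fibreMeasure]
  exact tendsto_fibreFunctional μ hι b f

/-- **IDENTIFICATION WITH THE FIBRE DENSITY**: for a real Schwartz–Bruhat `Φ` (locally constant, supported in a product of boxes —
so continuous with compact support), `∫ Φ ∂μ_{b,v} = Re F_Φ(b)` and `F_Φ(b) = ↑(∫ Φ ∂μ_{b,v})`: the measure REPRESENTS FILE A's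
functional `fibreDensity`. [cite: Weil1965, Chap. IV n° 44 Thm 2, p. 63] -/
theorem integral_fibreMeasure_eq_fibreDensity [Nonempty ι] [DecidableEq ι] [MeasurableSingletonClass K]
    (hι : 2 ≤ Fintype.card ι) (b : K) {Φ : (ι → K) × (ι → K) → ℝ} (hlc : IsLocallyConstant Φ)
    {n₀ : ℤ} (hs : ∀ z, z ∉ piPrimePowBall K ι n₀ ×ˢ piPrimePowBall K ι n₀ → Φ z = 0) :
    ((∫ z, Φ z ∂(fibreMeasure μ hι b) : ℝ) : ℂ) = fibreDensity μ (fun z => (Φ z : ℂ)) b := by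
  -- package `Φ` as an element of `C_c`
  have hcs : HasCompactSupport Φ := HasCompactSupport.intro' ((isCompact_piPrimePowBall n₀).prod
    (isCompact_piPrimePowBall n₀)) ((isClosed_piPrimePowBall n₀).prod (isClosed_piPrimePowBall n₀)) hs
  set f : C_c((ι → K) × (ι → K), ℝ) := ⟨⟨Φ, hlc.continuous⟩, hcs⟩ with hf
  have hfΦ : ∀ z, f z = Φ z := fun _ => rfl
  have h1 := tendsto_fibreAvgReal_integral_fibreMeasure μ hι b f
  have h2 := tendsto_fibreAvgReal_of_isLocallyConstant μ hι hlc hs b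
  have h12 : (∫ z, f z ∂(fibreMeasure μ hι b)) = (fibreDensity μ (fun z => (Φ z : ℂ)) b).re := tendsto_nhds_unique h1 h2
  simp only [hfΦ] at h12
  rw [h12]
  exact Complex.ext (by simp) (by simp [fibreDensity_ofReal_im μ hι hlc hs b])

/-! ## §4 Invariance of the fibre measure under dual pairs (`U(V)(F_v) ≅ GL_N` at a split place) -/

/-- the real fibre averages are invariant under a dual pair `(g, g′)` (`g u ⬝ᵥ g′ w = u ⬝ᵥ w`): ★ `integral_indicator_dotProduct_comp_dual`
on the complexified integrand. [cite: Weil1965, Chap. III n° 37, p. 54] -/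
theorem fibreAvgReal_comp_dual (g g' : (ι → K) ≃ₗ[K] (ι → K)) (hgg' : ∀ x y, g x ⬝ᵥ g' y = x ⬝ᵥ y)
    (f : (ι → K) × (ι → K) → ℝ) (b : K) (r : ℤ) :
    fibreAvgReal μ (fun z => f (g z.1, g' z.2)) b r = fibreAvgReal μ f b r := by
  have h := integral_indicator_dotProduct_comp_dual μ g g' hgg' (fun z => (f z : ℂ)) (b +ᵥ primePowBall K r)
  have h1 := ofReal_fibreAvgReal μ (fun z => f (g z.1, g' z.2)) b r
  have h2 := ofReal_fibreAvgReal μ f b r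
  rw [fibreAvg] at h1 h2
  rw [h] at h1
  exact_mod_cast h1.trans h2.symm

/-- **the fibre functional is invariant under dual pairs**: `Λ_b(f ∘ (g, g′)) = Λ_b(f)`.
[cite: Weil1965, Chap. V n° 49 Lemma 22, p. 70] -/
theorem fibreFunctional_comp_dual [Nonempty ι] [DecidableEq ι] [MeasurableSingletonClass K] (hι : 2 ≤ Fintype.card ι) (b : K)
    (g g' : (ι → K) ≃ₗ[K] (ι → K)) (hgg' : ∀ x y, g x ⬝ᵥ g' y = x ⬝ᵥ y)
    (f fT : C_c((ι → K) × (ι → K), ℝ)) (hfT : ∀ z, fT z = f (g z.1, g' z.2)) :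
    fibreFunctional μ hι b fT = fibreFunctional μ hι b f := by
  have h1 := tendsto_fibreFunctional μ hι b fT
  have h2 := tendsto_fibreFunctional μ hι b f
  have h3 : Tendsto (fun r : ℤ => fibreAvgReal μ fT b r) atTop (𝓝 (fibreFunctional μ hι b f)) := by
    refine h2.congr fun r => ?_
    have : (⇑fT : (ι → K) × (ι → K) → ℝ) = fun z => f (g z.1, g' z.2) := funext hfT
    rw [this, fibreAvgReal_comp_dual μ g g' hgg']
  exact tendsto_nhds_unique h1 h3

/-- **the fibre measure integrates `f ∘ (g, g′)` and `f` to the same value** for `f ∈ C_c` and every dual pair — `μ_{b,v}` is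
`G′_v = U(V)(F_v)`-INVARIANT (as an integral on continuous test functions; the measure-level statement follows by the
Riesz–Markov uniqueness). [cite: Weil1965, Chap. V n° 49 Lemma 22, p. 70] -/
theorem integral_fibreMeasure_comp_dual [Nonempty ι] [DecidableEq ι] [MeasurableSingletonClass K] (hι : 2 ≤ Fintype.card ι)
    (b : K) (g g' : (ι → K) ≃ₗ[K] (ι → K)) (hgg' : ∀ x y, g x ⬝ᵥ g' y = x ⬝ᵥ y)
    (f fT : C_c((ι → K) × (ι → K), ℝ)) (hfT : ∀ z, fT z = f (g z.1, g' z.2)) :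
    ∫ z, fT z ∂(fibreMeasure μ hι b) = ∫ z, f z ∂(fibreMeasure μ hι b) := by
  rw [integral_fibreMeasure, integral_fibreMeasure, fibreFunctional_comp_dual μ hι b g g' hgg' f fT hfT]

end Literature.NumberTheory.Weil1965.SplitPlace
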